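import Summits.HodgeConjecture.HodgeConjecture.Theorems.R90S6HeckeCoeffIndepOfIso     -- ★ W7-a.4 `coeff_toVector_comp_eq_of_memLaw`
import Summits.HodgeConjecture.HodgeConjecture.Theorems.R90S6IndexSeparatesU3       -- ★ W8-c `mem_orbit_of_ncard_orbit_eq_three`
import HarnessLib

/-!
# R90 · S6 «Ch. 14.1–14.5 stable trace formula» — WAVE 9-A card (A.1): «eG-INDEPENDENCE» FOR `U(σ, J₀)(K)`, `N = 3`, ABSTRACT V4 CURRENCY
# (`Theorems/R90S6HeckeCoeffIndepThree.lean`)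

Cell `hodgecm-mathlib`, crux H413 (`stmt-HodgeConjecture-24833`), route of record `HCCMUnconditional`; programme R90-TF, section S6
(base `R90-C14`), seat R90-C14-p06 (g0); S6 dealer R90-C14-plan (g2) «=» W9-A SHEET v1 + PROVISIONAL HANDS (R90 bus 2026-09-04T23:45:54Z:
«(A.1) → p06 (g0) after W8-c ★ (`Theorems/R90S6HeckeCoeffIndepThree.lean`)»; AUDIT BOX S6#W9-A SHEET 23:48:47Z).  Statement VERBATIM from the
typist's sheet `R90/R90-C14-typ1/g2/S6_wave9A_targets.v1.db09522d8f01f282.lean` :75–:88 (namespace `…R90.S6`, the sheet's `.Wave9A` dropped).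
Helper lane `--supports stmt-HodgeConjecture-24833 --as helper`; THEOREMS ONLY (no definition, no instance, no notation, no named fact, no `sorry`);
imports = ★ `Theorems/R90S6HeckeCoeffIndepOfIso` (W7-a.4) + ★ `Theorems/R90S6IndexSeparatesU3` (W8-c) + HarnessLib (no Lines import).

CONTENT.  `U = U(σ, J₀)(K)`, `J₀ = antidiag(1,1,1)`, over a discretely valued field `K` with an unramified local conjugation datum `hd` and finite
residue field `𝔽_{q²}` (`σ̄ = Frob_q`: the residual binders `hσO σk hσk hk hfrob` of W8-c, proof-route binders only), `K₀ = unitaryInt` hyperspecial.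
For ANY group `Gv` with a subgroup `Kv` and any two isomorphisms `e e' : Gv ≃* U` with the K-law `e g ∈ K₀ ↔ g ∈ Kv` (both), every `T ∈ ℋ(U, K₀)`
(generic coefficient ring `k`) is read as the SAME function `g ↦ (T [K₀])((e g) K₀)` on `Gv` — ★ W7-a.4 `coeff_toVector_comp_eq_of_memLaw` with its
one hypothesis `hsep` («the index `#(K₀ u K₀ ∕ K₀)` separates the `K₀`-double cosets of `U`») PAID by ★ W8-c `mem_orbit_of_ncard_orbit_eq_three`
(Cartan shells + strictly increasing shell indices `1, (q³+1)q, (q³+1)q⁵, …`).  ONE TERM.  The inert-place ∕ CM-dressed forms (A.2)∕(A.3) that the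
E1.3.9 ∕ E1.4.4.5a assemblies consume are p07 (g0)'s over ★ W8-c′; this is the abstract provider (J2 RULING: KEEP).

* **`coeff_toVector_comp_eq_of_memLaw_three`** — W9-A.1.

HONEST LABEL: a helper theorem, count-neutral until the E1.3.9 ∕ E1.4.4.5a assemblies consume (A.3); HC_CM is proved only modulo the 7 printed
citations (2 remaining named inputs: hLiu418 = stmt-HodgeConjecture-24832, h413 = stmt-HodgeConjecture-24833) until rung 0 closes; REL ≠ ★ ≠ BUILT.

## References
* [CartierCorvallis1979] P. Cartier, *Representations of 𝔭-adic groups: a survey*, PSPM 33.1 (1979), §I.3–I.4, §IV.1.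
* [BruhatTits1972] F. Bruhat, J. Tits, *Groupes réductifs sur un corps local I*, Publ. IHÉS 41 (1972), (4.4.3)–(4.4.4).
-/

set_option autoImplicit false
-- the mandated namespace repeats the single-problem summit's segment (`HodgeConjecture.HodgeConjecture`)
set_option linter.dupNamespace false

noncomputable section

open scoped Valued WithZero Matrix MatrixGroups

open MulAction MonoidAlgebra
open Literature.NumberTheory.Automorphic Literature.NumberTheory.Automorphic.HermitianLattice
  Literature.NumberTheory.Automorphic.UnitaryLatticeTree

namespace Summit.HodgeConjecture.HodgeConjecture.R90.S6

variable {k : Type*} [CommRing k]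
variable {K : Type*} [Field K] [Valued K ℤᵐ⁰] {σ : K →+* K} {ϖ : K}

/-- **W9-A.1** `coeff_toVector_comp_eq_of_memLaw_three` («eG-independence» for `U(σ, J₀)(K)`, `J₀ = antidiag(1,1,1)`, `K₀ = unitaryInt`, abstract
unramified datum with finite residue field `𝔽_{q²}`, `σ̄ = Frob_q`): any two isomorphisms `e e' : Gv ≃* U` carrying `Kv` onto `K₀` read every
`T ∈ ℋ(U, K₀)` as the SAME function `g ↦ (T [K₀])((e g) K₀)` on `Gv`.  ★ W7-a.4 `coeff_toVector_comp_eq_of_memLaw` with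
`hsep :=` ★ W8-c `mem_orbit_of_ncard_orbit_eq_three hd hσO σk hσk hk hfrob`. [cite: CartierCorvallis1979, §IV.1] [cite: BruhatTits1972, (4.4.3)] -/
theorem coeff_toVector_comp_eq_of_memLaw_three (hd : UnramifiedLocalConjDatum σ ϖ) (hσO : ∀ x : 𝒪[K], σ x ∈ 𝒪[K]) (σk : 𝓀[K] →+* 𝓀[K])
    (hσk : ∀ x : 𝒪[K], IsLocalRing.residue 𝒪[K] ⟨σ x, hσO x⟩ = σk (IsLocalRing.residue 𝒪[K] x))
    [Fintype 𝓀[K]] {q : ℕ} (hk : Fintype.card 𝓀[K] = q ^ 2) (hfrob : ∀ y, σk y = y ^ q)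
    {Gv : Type*} [Group Gv] (Kv : Subgroup Gv)
    (e e' : Gv ≃* ↥(unitaryGroupOfForm σ ((StdForm.antidiagonal 3).over K)))
    (he : ∀ g, e g ∈ unitaryInt σ ((StdForm.antidiagonal 3).over K) ↔ g ∈ Kv)
    (he' : ∀ g, e' g ∈ unitaryInt σ ((StdForm.antidiagonal 3).over K) ↔ g ∈ Kv)
    (T : heckeAlgebra k ↥(unitaryGroupOfForm σ ((StdForm.antidiagonal 3).over K)) (unitaryInt σ ((StdForm.antidiagonal 3).over K))) :
    (fun g : Gv => (heckeAlgebra.toVector (unitaryInt σ ((StdForm.antidiagonal 3).over K)) T).coeff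
        ((e' g : ↥(unitaryGroupOfForm σ ((StdForm.antidiagonal 3).over K))) :
          ↥(unitaryGroupOfForm σ ((StdForm.antidiagonal 3).over K)) ⧸ unitaryInt σ ((StdForm.antidiagonal 3).over K))) =
      fun g : Gv => (heckeAlgebra.toVector (unitaryInt σ ((StdForm.antidiagonal 3).over K)) T).coeff
        ((e g : ↥(unitaryGroupOfForm σ ((StdForm.antidiagonal 3).over K))) :
          ↥(unitaryGroupOfForm σ ((StdForm.antidiagonal 3).over K)) ⧸ unitaryInt σ ((StdForm.antidiagonal 3).over K)) :=
  coeff_toVector_comp_eq_of_memLaw Kv (unitaryInt σ ((StdForm.antidiagonal 3).over K))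
    (fun u u' h => mem_orbit_of_ncard_orbit_eq_three hd hσO σk hσk hk hfrob u u' h) e e' he he' T

end Summit.HodgeConjecture.HodgeConjecture.R90.S6

end
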